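import Literature.Computability.AlgebraicComplexity.DIP20MonomialCounts
import HarnessLib

/-!
# Dörfler–Ikenmeyer–Panova 2019, Prop. 3.15 table row 4, part A: the six monomial counts `c_ν(6,5)`
# at `ν ∈ (12,9,9) + S_3 - id`

Topic `Literature/Computability/AlgebraicComplexity`; certificate data for `DIP20PlethysmValuesRow4.lean`
(`a_{(12,9,9)}(6[5]) = 1`), split off so that every file stays within one farm elaboration budget. Each
count is one `decide +kernel` on the list counter `countVecMultisetsL` of `DIP20MonomialCounts.lean`
(`≈ 2·10³` multisets per count); the values agree with an independent desk computation. No definitions,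
no named facts. HONEST FRAMING: toy-model arithmetic; VP ≠ VNP is not proved.

## References

* J. Dörfler, C. Ikenmeyer, G. Panova, SIAM J. Appl. Algebra Geom. 4 (2020) = arXiv:1901.04576,
  Prop. 3.15 and its table (arXiv pp. 7–8; TeX `multobs.tex` L513 `{pro:occobsdoexist}`), eqs. (4.3)–(4.4)
  (arXiv p. 9). [DorflerIkenmeyerPanova2020]
-/

namespace Literature.Computability.AlgebraicComplexity

/-- `c_{(12,9,9)}(6,5) = 2230`. [cite: DorflerIkenmeyerPanova2020, eq. (4.3) (arXiv p. 9)] -/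
theorem countVecMultisetsL_5_6_12_9_9 : countVecMultisetsL (weakCompsL 3 5) 6 [12, 9, 9] = 2230 := by
  decide +kernel

/-- `c_{(13,8,9)}(6,5) = 1945`. [cite: DorflerIkenmeyerPanova2020, eq. (4.3) (arXiv p. 9)] -/
theorem countVecMultisetsL_5_6_13_8_9 : countVecMultisetsL (weakCompsL 3 5) 6 [13, 8, 9] = 1945 := by
  decide +kernel

/-- `c_{(12,10,8)}(6,5) = 2147`. [cite: DorflerIkenmeyerPanova2020, eq. (4.3) (arXiv p. 9)] -/
theorem countVecMultisetsL_5_6_12_10_8 : countVecMultisetsL (weakCompsL 3 5) 6 [12, 10, 8] = 2147 := by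
  decide +kernel

/-- `c_{(14,9,7)}(6,5) = 1575`. [cite: DorflerIkenmeyerPanova2020, eq. (4.3) (arXiv p. 9)] -/
theorem countVecMultisetsL_5_6_14_9_7 : countVecMultisetsL (weakCompsL 3 5) 6 [14, 9, 7] = 1575 := by
  decide +kernel

/-- `c_{(13,10,7)}(6,5) = 1775`. [cite: DorflerIkenmeyerPanova2020, eq. (4.3) (arXiv p. 9)] -/
theorem countVecMultisetsL_5_6_13_10_7 : countVecMultisetsL (weakCompsL 3 5) 6 [13, 10, 7] = 1775 := by
  decide +kernel

/-- `c_{(14,8,8)}(6,5) = 1663`. [cite: DorflerIkenmeyerPanova2020, eq. (4.3) (arXiv p. 9)] -/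
theorem countVecMultisetsL_5_6_14_8_8 : countVecMultisetsL (weakCompsL 3 5) 6 [14, 8, 8] = 1663 := by
  decide +kernel

end Literature.Computability.AlgebraicComplexity
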